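import Literature.AlgebraicGeometry.AbelianSchemes.PolarizationOfLineBundleLift
import Literature.AlgebraicGeometry.AbelianSchemes.AbelianSchemeDualTransportOfBaseChangeAnyBase
import Literature.AlgebraicGeometry.AbelianSchemes.AbelianSchemeDualPairNormalize
import HarnessLib

/-!
# F-11 cut α, pieces α2 + α3 assembled: from a lift of the pair `(A₀, L^Δ(λ₀))` and ANY dual pair of the lifted abelian
# scheme, the LEVEL-FREE polarised lift in the relation form of `stub_polarizedLift`
# ([MumfordFogartyKirwan1994] Ch. 6 §1 Cor. 6.8, §2 Prop. 6.10–6.11; [Oort1971] §2)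

Layer `Literature/AlgebraicGeometry/AbelianSchemes`, namespace `Literature.AlgebraicGeometry.AbelianSchemes.AbelianSchemeOver`.
THEOREMS ONLY (no definition, no named fact, no instance, no notation, no `sorry`).  Cell `hodgecm-mathlib` (D-0151 / D-0183
FLOOR 0), programme P1 sub-line F-11 (`Cruxes/HDel/Lines/F11SmoothRoadA.lean`, stub `stub_polarizedLift`, v1 cut α; B-p05
(g19)).  Count-neutral capital; HC_CM is proved only modulo the 7 printed citations until rung 0 closes, and nothing here is
about HC.

With this file the registered stub `stub_polarizedLift` reduces to EXACTLY two inputs: (α1) a lift `X` of `A₀` together with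
a rigidified line bundle `L` on `X` restricting to `L^Δ(λ₀)` (the deformation theory of PAIRS — the F-3-free heart), and
(F-3 at the base `S`) SOME dual pair of `X` — [MumfordFogartyKirwan1994] Cor. 6.8 over the Artin base.  Everything else is ★ or
★-in-HOME: the dual pair is renormalised (★ `DualPair.normalize`), the dual transport `Ĝ` with its group-scheme square and
Poincaré clause is ★ `hatTransportOfBaseChange` (FILE A / A2 of the dual-transport series — this is piece α2, pure glue), and the
polarisation with its `λ`-clause is piece α3 (★-in-HOME `exists_polarization_of_lineBundle_lift`).

* `exists_polarizedLift_of_lineBundle_lift` — conclusion = the `(D, pol, Ĝ, hĜ, Poincaré, λ-clause)` tail of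
  `stub_polarizedLift` for the GIVEN lift `X` (the producer adds `X`, `IsOfRelDim`, `G`, `hG`).

## References
* [MumfordFogartyKirwan1994] D. Mumford, J. Fogarty, F. Kirwan, *Geometric Invariant Theory*, 3rd ed. (1994), Ch. 6 §1
  Cor. 6.8 (p. 118); §2 Def. 6.3 (p. 120), Prop. 6.10 (p. 121), Prop. 6.11 (p. 122); App. 7A (pp. 234–235).
* [Oort1971] F. Oort, *Finite group schemes, local moduli for abelian varieties, and lifting problems*, Compos. Math. 23
  (1971), §2.3–2.4.
* [MilneAV2008] J. S. Milne, *Abelian Varieties* (2008), I §8 pp. 36–37.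
-/

set_option backward.isDefEq.respectTransparency false

noncomputable section

open CategoryTheory CategoryTheory.Limits AlgebraicGeometry MonoidalCategory CartesianMonoidalCategory
open scoped MonObj

universe u

namespace Literature.AlgebraicGeometry.AbelianSchemes

open Literature.AlgebraicGeometry.Motives Literature.AlgebraicGeometry.Modules
  Literature.AlgebraicGeometry.AbelianVarieties

namespace AbelianSchemeOver

variable {S₀ S : Scheme.{u}} {i : S₀ ⟶ S} [IsClosedImmersion i] [Surjective i]
  [IsLocallyNoetherian S] [PreconnectedSpace S] [IsLocallyNoetherian S₀] [PreconnectedSpace S₀] [Nonempty S₀]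
  {A₀ : AbelianSchemeOver S₀} (X : AbelianSchemeOver S) {G : A₀.X.left ⟶ X.X.left}

/-- **F-11 cut α, pieces α2 + α3: the level-free polarised lift from a lift of the pair `(A₀, L^Δ(λ₀))` and any dual pair
of the lift.**  Let `i : S₀ → S` be a surjective closed immersion of connected locally Noetherian schemes with `2` invertible
on both, `G : A₀ → X` over `i` a base-change square of abelian schemes (★ `IsBaseChangeVia`), `D₀ = (Â₀, 𝒫₀)` a dual pair of
`A₀` normalised on `A₀ × {ε̂}`, `λ₀` a polarisation with graph `Gr₀`, `L` a rank-one module on `X` rigidified along `ε_X` with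
`G^*L ≅ L^Δ(λ₀) = Gr₀^*𝒫₀`, and `DX` ANY dual pair of `X`.  Then for `D := DX.normalize` there are a polarisation `pol` of
`X` w.r.t. `D` and `Ĝ : Â₀ → X̂` over `i` — a base-change square of group schemes — with the Poincaré clause `(G × Ĝ)^*𝒫 ≅ 𝒫₀`
and the `λ`-clause `λ₀ ≫ Ĝ = G ≫ pol.lam` (★ `hatTransportOfBaseChange`, ★-in-HOME α3).
[cite: MumfordFogartyKirwan1994, Ch. 6 §1 Cor. 6.8 (p. 118) and §2 Proposition 6.10–6.11 (pp. 121–122)]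
[cite: MilneAV2008, I §8 pp. 36–37] -/
theorem exists_polarizedLift_of_lineBundle_lift (h2 : ∀ s : S, (2 : S.residueField s) ≠ 0)
    (h2₀ : ∀ s : S₀, (2 : S₀.residueField s) ≠ 0) (hG : A₀.IsBaseChangeVia X i G) (D₀ : A₀.DualPair)
    (hD₀ : Nonempty ((Scheme.Modules.pullback (DualPair.unitHatSlice D₀)).obj D₀.P ≅ SheafOfModules.unit _))
    (pol₀ : A₀.Polarization D₀) (Gr₀ : A₀.X.left ⟶ A₀.prodLeft D₀.hat)
    (hGr₁ : Gr₀ ≫ pullback.fst A₀.X.hom D₀.hat.X.hom = 𝟙 _) (hGr₂ : Gr₀ ≫ pullback.snd A₀.X.hom D₀.hat.X.hom = pol₀.lam.left)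
    (DX : X.DualPair) {L : X.left.Modules} (hL : HasRank L 1)
    (hε : CechPic.pullback X.unitSection (detClass (HasRank.isFiniteLocallyFree' hL)) = 1)
    (hLΔ : Nonempty ((Scheme.Modules.pullback G).obj L ≅ (Scheme.Modules.pullback Gr₀).obj D₀.P)) :
    ∃ (D : X.DualPair) (pol : X.Polarization D) (Ĝ : D₀.hat.X.left ⟶ D.hat.X.left)
      (hĜ : D₀.hat.IsBaseChangeVia D.hat i Ĝ),
      Nonempty ((Scheme.Modules.pullback
        (pullback.map A₀.X.hom D₀.hat.X.hom X.X.hom D.hat.X.hom G Ĝ i hG.fst.symm hĜ.fst.symm)).obj D.P ≅ D₀.P) ∧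
      pol₀.lam.left ≫ Ĝ = G ≫ pol.lam.left := by
  -- renormalise the given dual pair of the lift
  let D : X.DualPair := DX.normalize
  have hD : Nonempty ((Scheme.Modules.pullback (DualPair.unitHatSlice D)).obj D.P ≅ SheafOfModules.unit _) :=
    DX.nonempty_unitHatSlice_iso_normalize
  -- α2: THE dual transport along the square, its group-scheme square and its Poincaré clause
  let Ĝ : D₀.hat.X.left ⟶ D.hat.X.left := DualPair.hatTransportOfBaseChange D D₀ hG
  have hĜ : D₀.hat.IsBaseChangeVia D.hat i Ĝ :=
    DualPair.hat_isBaseChangeVia_hatTransportOfBaseChange_of_isLocallyNoetherian_base D D₀ hG hD hD₀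
  have hP : Nonempty ((Scheme.Modules.pullback
      (pullback.map A₀.X.hom D₀.hat.X.hom X.X.hom D.hat.X.hom G Ĝ i hG.fst.symm hĜ.fst.symm)).obj D.P ≅ D₀.P) :=
    DualPair.nonempty_pullback_map_hatTransportOfBaseChange_iso D D₀ hG hG.fst.symm hĜ.fst.symm
  -- α3
  obtain ⟨pol, hclause⟩ :=
    exists_polarization_of_lineBundle_lift (X := X) (i := i) h2 h2₀ hG D₀ hD₀ D hD hĜ hP pol₀ Gr₀ hGr₁ hGr₂ hL hε hLΔ
  exact ⟨D, pol, Ĝ, hĜ, hP, hclause⟩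

end AbelianSchemeOver

end Literature.AlgebraicGeometry.AbelianSchemes

end
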